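import Summits.Ventures.PercRepro.RankLevelSetLevelFiveSharpXXI

/-!
# PercRepro — THE COLOOP STEP OF A CELL, SCALED: `RLS M (p+1) (q+1)` FROM `(Φ(p+1, q+1)/2)·#U(p, q+1) ≤ #Y(p, q+1)` ON `M ＼ e` (p7, gen 7; sub-claim S2; generic)

A cell `(p + 1, d)` of the `e`-free core may have coloops (the wrapper `rls_succ_large` routes them to the core). For a coloop `e`,
night-1's identities `#U_M(p+1, q+1) = #U_{M∖e}(p, q+1)` (`topCount_eq_of_isColoop_of_eRank`) and
`#Y_M(p+1, q+1) = 2·#Y_{M∖e}(p, q+1) + W_p + W_{q+1} ≥ 2·#Y_{M∖e}(p, q+1)` (`midCount_eq_of_isColoop_q`) reduce the cell to the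
SCALED cell of `M ∖ e` at rank `p`, corank `d`, weight `Φ(p + 1, q + 1)/2` — and since `Φ(p + 1, q + 1)/2 ≤ Φ(p, q + 1)·(p + 1)/(p + q + 2)`,
the scaled cell is EASIER than the cell `(p, d)` (≈ 0.78 of it at `p = 17`, `q = 4`): **`rls_of_isColoop_scaled`**. Used at the cell `(18, 7)`
(S2CoreEighteenSeven) with the general-weight core `c025_core_five_sharp_cell_xqictq5g`; offered to S1 (`q = 3`) and S3 (`q = 5`).
`hfree_delete_singleton` (S2CoreEighteenSeven) keeps `M ∖ e` an `e`-free core. Axioms: standard.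
-/

open scoped Matroid

namespace PercRepro

namespace ThmN

variable {α : Type}

/-- **The coloop step, scaled**: `e` a coloop, `r(M) = p + 1`, `q + 1 < p`; if `M ＼ {e}` satisfies the scaled cell
`(Φ(p+1, q+1)/2)·#U(p, q+1) ≤ #Y(p, q+1)` then `M` satisfies `Φ(p+1, q+1)·#U(p+1, q+1) ≤ #Y(p+1, q+1)`. -/
theorem rls_of_isColoop_scaled (M : Matroid α) [M.Finite] {e : α} (he : M.IsColoop e) {p q : ℕ} (hp : q + 1 < p)
    (hR : M.eRank = ((p + 1 : ℕ) : ℕ∞))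
    (h : phiK (p + 1) (q + 1) / 2 * (Matroid.topCount (M ＼ {e}) p (q + 1) : ℚ) ≤
      (Matroid.midCount (M ＼ {e}) p (q + 1) : ℚ)) :
    RLS M (p + 1) (q + 1) := by
  rw [RLS_iff, Matroid.topCount_eq_of_isColoop_of_eRank he q hR, Matroid.midCount_eq_of_isColoop_q he hp]
  push_cast
  have h0 : (0 : ℚ) ≤ (Matroid.levelCount (M ＼ {e}) p : ℚ) := by positivity
  have h0' : (0 : ℚ) ≤ (Matroid.levelCount (M ＼ {e}) (q + 1) : ℚ) := by positivity
  linarith [h, h0, h0']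

end ThmN

end PercRepro
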